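import Summits.NavierStokesRegularity.NavierStokesRegularity.Theorems.ExtremiserTransienceNearExtremalTransienceExtremiserLiouvilleConstantSpeedMultiplierHelicity
import HarnessLib

/-!
# Crux `ExtremiserTransience.NearExtremalTransience` (stmt-NavierStokesRegularity-21883), line `extremiser_liouville`,
# stub K1b — THE STRONG EULER–LAGRANGE SYSTEM OF THE RESIDUE OBJECT ON THE TWIST SET `{⟪v, curl v⟫ ≠ 0}`

`--supports stmt-NavierStokesRegularity-21883` (helper).  Author: prover seat `ns-el-k1b` (g3).

Continuation of `…ConstantSpeedMultiplierHelicity` (`∫⟪G,η⟫dx = ∫⟪v, curl η⟫dμ`; `⟪v,curl v⟫μ = ⟪G,v⟫dx`).  Write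
`h := ⟪v, curl v⟫` (twist / helicity density of the constant-speed field), `g := ⟪G, v⟫`, `q := g/h`, and let
`U := {h ≠ 0}` (open; dense when `v` is analytic and not twist-free).

* `multiplier_eq_density_on_twist_ne_zero` : **on `U` the multiplier IS the function `q = ⟪G,v⟫/⟪v,curl v⟫`**:
  `∫ θ dμ = ∫ θ·q dx` for every `θ ∈ C_c^∞` with `tsupport θ ⊆ U` (helicity identity tested with `θ/h`).  In particular
  `q ≥ 0` on `U`, `q ∈ L¹(U)` with `∫_U q ≤ μ(ℝ³) ≤ κ⋆²ZW`, and the singular part of `μ` lives on the analytic set `{h = 0}`.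
* `integral_inner_curl_eq_of_contDiffOn` : curl-adjointness `∫⟪curl F, Ψ⟫ = ∫⟪F, curl Ψ⟫` for `F` smooth only on an
  open set containing `tsupport Ψ` (divergence theorem for the globally `C¹_c` field `Ψ × F`).
* `strongEulerLagrange_on_twist_ne_zero` : **THE STRONG E–L SYSTEM: `G = curl (q v) ( = ∇q × v + q ω)` at every point
  of `U`** — with `G` the explicit fifth-order Euler–Lagrange density of `…KStarAttainedEulerLagrange` this is a closed
  OVERDETERMINED analytic PDE system for the residue object (`v` unit-sphere valued and divergence free: 2 unknown
  functions; `G = curl(qv)`: 3 equations, of which `⟪·, v⟫` is the definition of `q`), plus the sign condition `q ≥ 0`.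
* `residue_strongEulerLagrange` : the package for the residue object with the explicit `G` (all inputs discharged).

WHAT THIS IS NOT: necessary conditions on the HYPOTHETICAL K1b residue object; K1b is NOT proved; nothing here
proves NS regularity. [folklore]
-/

noncomputable section

open Set Filter Topology MeasureTheory Metric Function
open scoped ENNReal NNReal Topology InnerProductSpace RealInnerProductSpace ContDiff Laplacian
open Literature.Analysis.FluidPDE Literature.Analysis

namespace Summit.NavierStokesRegularity.NavierStokesRegularity.Theorems

-- the problem directory repeats the summit name (`NavierStokesRegularity/NavierStokesRegularity`)
set_option linter.dupNamespace false

namespace ExtremiserLiouville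

open DepletionLadder.KStar DepletionLadder.KStar.HalfSpace

variable {v G : E3 → E3} {M : ℝ} {μ : Measure E3}

/-! ## Calculus helpers: functions smooth on an open set containing a support -/

/-- `θ/h` is smooth when `θ, h` are smooth and `h ≠ 0` on `tsupport θ` (off `tsupport θ` the quotient is locally `0`).
[folklore] -/
theorem contDiff_div_of_ne_zero_on_tsupport {θ h : E3 → ℝ} (hθ : ContDiff ℝ ∞ θ) (hh : ContDiff ℝ ∞ h)
    (hne : ∀ x ∈ tsupport θ, h x ≠ 0) : ContDiff ℝ ∞ fun x => θ x / h x := by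
  refine contDiff_iff_contDiffAt.2 fun x => ?_
  by_cases hx : x ∈ tsupport θ
  · exact hθ.contDiffAt.div hh.contDiffAt (hne x hx)
  · have hev : (fun y => θ y / h y) =ᶠ[𝓝 x] fun _ => 0 := by
      filter_upwards [notMem_tsupport_iff_eventuallyEq.1 hx] with y hy
      rw [hy, Pi.zero_apply, zero_div]
    exact contDiffAt_const.congr_of_eventuallyEq hev

/-- **Curl adjointness with a field smooth only near the support of the test field**: if `F` is `C^∞` on an open set
`U ⊇ tsupport Ψ` and `Ψ ∈ C^∞_c`, then `∫⟪curl F, Ψ⟫ = ∫⟪F, curl Ψ⟫` (the field `Ψ × F` is globally `C¹_c`). [folklore] -/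
theorem integral_inner_curl_eq_of_contDiffOn {U : Set E3} (hU : IsOpen U) {F Ψ : E3 → E3}
    (hF : ContDiffOn ℝ ∞ F U) (hΨ : ContDiff ℝ ∞ Ψ) (hc : HasCompactSupport Ψ) (hsub : tsupport Ψ ⊆ U) :
    ∫ x, ⟪curl F x, Ψ x⟫_ℝ = ∫ x, ⟪F x, curl Ψ x⟫_ℝ := by
  have hFx : ∀ x ∈ U, ContDiffAt ℝ ∞ F x := fun x hx => hF.contDiffAt (hU.mem_nhds hx)
  have hΨ0 : ∀ x, x ∉ U → Ψ =ᶠ[𝓝 x] 0 := fun x hx => notMem_tsupport_iff_eventuallyEq.1 fun h => hx (hsub h)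
  -- the field `X = Ψ × F` is globally `C¹` with compact support
  have hX : ContDiff ℝ 1 fun y => cross (Ψ y) (F y) := by
    refine contDiff_iff_contDiffAt.2 fun x => ?_
    by_cases hx : x ∈ U
    · exact ((crossCLM.contDiff.comp hΨ).contDiffAt.clm_apply (hFx x hx)).of_le (by norm_cast)
    · have hev : (fun y => cross (Ψ y) (F y)) =ᶠ[𝓝 x] fun _ => 0 := by
        filter_upwards [hΨ0 x hx] with y hy
        rw [hy, Pi.zero_apply]
        simp [← crossCLM_apply]
      exact contDiffAt_const.congr_of_eventuallyEq hev
  have hXc : HasCompactSupport fun y => cross (Ψ y) (F y) := by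
    refine hc.mono fun x hx => ?_
    contrapose! hx
    simp only [mem_support, not_not] at hx
    simp [← crossCLM_apply, hx]
  have h0 := integral_divergence_eq_zero hX hXc
  -- pointwise: `div (Ψ × F) = ⟪F, curl Ψ⟫ − ⟪Ψ, curl F⟫` (on `U` by Leibniz; off `U` both sides vanish)
  have hpt : ∀ x, VectorCalculus.divergence (fun y => cross (Ψ y) (F y)) x = ⟪F x, curl Ψ x⟫_ℝ - ⟪Ψ x, curl F x⟫_ℝ := by
    intro x
    by_cases hx : x ∈ U
    · exact divergence_cross_holds Ψ F x (hΨ.differentiable (by simp) x) ((hFx x hx).differentiableAt (by simp))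
    · have hxΨ : x ∉ tsupport Ψ := fun h => hx (hsub h)
      have hΨx : Ψ x = 0 := image_eq_zero_of_notMem_tsupport hxΨ
      have hcΨ : curl Ψ x = 0 := curl_eq_zero_of_notMem_tsupport hxΨ
      have hev : (fun y => cross (Ψ y) (F y)) =ᶠ[𝓝 x] fun _ => 0 := by
        filter_upwards [hΨ0 x hx] with y hy
        rw [hy, Pi.zero_apply]
        simp [← crossCLM_apply]
      unfold VectorCalculus.divergence
      rw [hev.fderiv_eq, fderiv_const_apply, hΨx, hcΨ, inner_zero_left, inner_zero_right, sub_zero]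
      simp
  -- both pairings are continuous with compact support
  have hcurlF : ∀ x ∈ U, ContinuousAt (curl F) x := fun x hx => by
    rw [curl_eq_curlCLM_comp]
    exact curlCLM.continuous.continuousAt.comp ((hFx x hx).fderiv_right (m := ∞) le_rfl).continuousAt
  have hsuppL : support (fun x => ⟪Ψ x, curl F x⟫_ℝ) ⊆ support Ψ := fun x hx => by
    rw [mem_support] at hx ⊢
    intro h0
    exact hx (by rw [h0, inner_zero_left])
  have hsuppR : support (fun x => ⟪F x, curl Ψ x⟫_ℝ) ⊆ support (curl Ψ) := fun x hx => by
    rw [mem_support] at hx ⊢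
    intro h0
    exact hx (by rw [h0, inner_zero_right])
  have htsL : tsupport (fun x => ⟪Ψ x, curl F x⟫_ℝ) ⊆ U := (closure_mono hsuppL).trans hsub
  have htsR : tsupport (fun x => ⟪F x, curl Ψ x⟫_ℝ) ⊆ U :=
    (closure_mono hsuppR).trans ((tsupport_curl_subset Ψ).trans hsub)
  have cL : Continuous fun x => ⟪Ψ x, curl F x⟫_ℝ :=
    continuous_of_tsupport fun x hx => hΨ.continuous.continuousAt.inner (hcurlF x (htsL hx))
  have cR : Continuous fun x => ⟪F x, curl Ψ x⟫_ℝ :=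
    continuous_of_tsupport fun x hx =>
      (hFx x (htsR hx)).continuousAt.inner (continuous_curl (hΨ.of_le (by norm_cast))).continuousAt
  have iL : Integrable (fun x => ⟪Ψ x, curl F x⟫_ℝ) := cL.integrable_of_hasCompactSupport (hc.mono hsuppL)
  have iR : Integrable (fun x => ⟪F x, curl Ψ x⟫_ℝ) :=
    cR.integrable_of_hasCompactSupport ((hasCompactSupport_curl hc).mono hsuppR)
  simp_rw [hpt] at h0
  rw [integral_sub iR iL, sub_eq_zero] at h0
  rw [h0]
  exact integral_congr_ae (Eventually.of_forall fun x => real_inner_comm _ _)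

/-! ## On the twist set the multiplier is the function `⟪G, v⟫ / ⟪v, curl v⟫` -/

/-- **`μ = (⟪G,v⟫/⟪v,curl v⟫) dx` on `{⟪v, curl v⟫ ≠ 0}`**: for every smooth compactly supported `θ` whose support avoids
the zero set of the twist, `∫ θ dμ = ∫ θ · ⟪G,v⟫/⟪v,curl v⟫ dx` (helicity identity with `ψ = θ/⟪v, curl v⟫`). [folklore] -/
theorem multiplier_eq_density_on_twist_ne_zero (hv : ContDiff ℝ ∞ v)
    (hG : ∀ η : E3 → E3, ContDiff ℝ ∞ η → HasCompactSupport η →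
      Jst v * J1 v (curl η) - kStar ^ 2 * M ^ 2 * (Wpa v * A1 v (curl η) + Zen v * C1 v (curl η)) = ∫ x, ⟪G x, η x⟫_ℝ)
    (hμ : ∀ φ : E3 → E3, ContDiff ℝ ∞ φ → HasCompactSupport φ → VectorCalculus.IsDivFree φ →
      Jst v * J1 v φ - kStar ^ 2 * M ^ 2 * (Wpa v * A1 v φ + Zen v * C1 v φ) = ∫ x, ⟪v x, φ x⟫_ℝ ∂μ)
    {θ : E3 → ℝ} (hθ : ContDiff ℝ ∞ θ) (hθc : HasCompactSupport θ)
    (hθU : tsupport θ ⊆ {x | ⟪v x, curl v x⟫_ℝ ≠ 0}) :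
    ∫ x, θ x ∂μ = ∫ x, θ x * (⟪G x, v x⟫_ℝ / ⟪v x, curl v x⟫_ℝ) := by
  have hh : ContDiff ℝ ∞ fun x => ⟪v x, curl v x⟫_ℝ := hv.inner ℝ (contDiff_curl_top hv)
  have hψ : ContDiff ℝ ∞ fun x => θ x / ⟪v x, curl v x⟫_ℝ :=
    contDiff_div_of_ne_zero_on_tsupport hθ hh fun x hx => hθU hx
  have hψc : HasCompactSupport fun x => θ x / ⟪v x, curl v x⟫_ℝ :=
    hθc.mono fun x hx => by
      rw [mem_support] at hx ⊢
      intro h0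
      exact hx (by rw [h0, zero_div])
  have hid := multiplier_helicity_identity hv hG hμ hψ hψc
  have h1 : ∀ x, θ x / ⟪v x, curl v x⟫_ℝ * ⟪v x, curl v x⟫_ℝ = θ x := fun x => by
    by_cases hx : ⟪v x, curl v x⟫_ℝ = 0
    · have hθx : θ x = 0 := by
        by_contra hne
        exact hθU (subset_tsupport _ (mem_support.2 hne)) hx
      rw [hθx, zero_div, zero_mul]
    · field_simp
  have h2 : ∀ x, θ x / ⟪v x, curl v x⟫_ℝ * ⟪G x, v x⟫_ℝ = θ x * (⟪G x, v x⟫_ℝ / ⟪v x, curl v x⟫_ℝ) :=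
    fun x => by ring
  simp only [h1, h2] at hid
  exact hid.symm

/-! ## The strong Euler–Lagrange system on the twist set -/

/-- **STRONG EULER–LAGRANGE SYSTEM: `G = curl (q v)` on `{⟪v, curl v⟫ ≠ 0}`, `q = ⟪G,v⟫/⟪v,curl v⟫`** (for smooth
`G`): the distributional equation `G dx = curl(vμ)` with `μ = q dx` on the open twist set, integrated by parts
(`integral_inner_curl_eq_of_contDiffOn`) and localised (du Bois-Reymond on the open set). [folklore] -/
theorem strongEulerLagrange_on_twist_ne_zero (hv : ContDiff ℝ ∞ v) (hGs : ContDiff ℝ ∞ G)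
    (hG : ∀ η : E3 → E3, ContDiff ℝ ∞ η → HasCompactSupport η →
      Jst v * J1 v (curl η) - kStar ^ 2 * M ^ 2 * (Wpa v * A1 v (curl η) + Zen v * C1 v (curl η)) = ∫ x, ⟪G x, η x⟫_ℝ)
    (hμ : ∀ φ : E3 → E3, ContDiff ℝ ∞ φ → HasCompactSupport φ → VectorCalculus.IsDivFree φ →
      Jst v * J1 v φ - kStar ^ 2 * M ^ 2 * (Wpa v * A1 v φ + Zen v * C1 v φ) = ∫ x, ⟪v x, φ x⟫_ℝ ∂μ)
    {x₀ : E3} (hx₀ : ⟪v x₀, curl v x₀⟫_ℝ ≠ 0) :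
    G x₀ = curl (fun y => (⟪G y, v y⟫_ℝ / ⟪v y, curl v y⟫_ℝ) • v y) x₀ := by
  set U : Set E3 := {x | ⟪v x, curl v x⟫_ℝ ≠ 0} with hUdef
  have hh : ContDiff ℝ ∞ fun x => ⟪v x, curl v x⟫_ℝ := hv.inner ℝ (contDiff_curl_top hv)
  have hg : ContDiff ℝ ∞ fun x => ⟪G x, v x⟫_ℝ := hGs.inner ℝ hv
  have hUo : IsOpen U := isOpen_ne_fun hh.continuous continuous_const
  have hF : ContDiffOn ℝ ∞ (fun y => (⟪G y, v y⟫_ℝ / ⟪v y, curl v y⟫_ℝ) • v y) U := fun x hx =>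
    ((hg.contDiffAt.div hh.contDiffAt hx).smul hv.contDiffAt).contDiffWithinAt
  have hFx : ∀ x ∈ U, ContDiffAt ℝ ∞ (fun y => (⟪G y, v y⟫_ℝ / ⟪v y, curl v y⟫_ℝ) • v y) x := fun x hx =>
    hF.contDiffAt (hUo.mem_nhds hx)
  -- `Φ := G − curl (q v)` is continuous on `U`
  have hcurlF : ContinuousOn (curl fun y => (⟪G y, v y⟫_ℝ / ⟪v y, curl v y⟫_ℝ) • v y) U := by
    rw [curl_eq_curlCLM_comp]
    exact curlCLM.continuous.comp_continuousOn (hF.continuousOn_fderiv_of_isOpen hUo (by simp))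
  have hΦc : ContinuousOn (fun x => G x - curl (fun y => (⟪G y, v y⟫_ℝ / ⟪v y, curl v y⟫_ℝ) • v y) x) U :=
    hGs.continuous.continuousOn.sub hcurlF
  -- the weak identity against `θ • e`, `θ ∈ C_c^∞(U)`
  have key : ∀ θ : E3 → ℝ, ContDiff ℝ ∞ θ → HasCompactSupport θ → tsupport θ ⊆ U → ∀ e : E3,
      ∫ x, ⟪G x, θ x • e⟫_ℝ = ∫ x, ⟪curl (fun y => (⟪G y, v y⟫_ℝ / ⟪v y, curl v y⟫_ℝ) • v y) x, θ x • e⟫_ℝ := by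
    intro θ hθ hθc hθU e
    have hη : ContDiff ℝ ∞ fun x => θ x • e := hθ.smul contDiff_const
    have hηc : HasCompactSupport fun x => θ x • e := hθc.smul_right
    have hηU : tsupport (fun x => θ x • e) ⊆ U := (tsupport_smul_subset_left _ _).trans hθU
    rw [multiplier_curl_identity hG hμ hη hηc]
    have hσ : ContDiff ℝ ∞ fun x => ⟪v x, curl (fun y => θ y • e) x⟫_ℝ := hv.inner ℝ (contDiff_curl_top hη)
    have hσc : HasCompactSupport fun x => ⟪v x, curl (fun y => θ y • e) x⟫_ℝ :=
      hasCompactSupport_inner_of_right v (hasCompactSupport_curl hηc)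
    have hσsupp : support (fun x => ⟪v x, curl (fun y => θ y • e) x⟫_ℝ) ⊆ support (curl fun y => θ y • e) :=
      fun x hx => by
        rw [mem_support] at hx ⊢
        intro h0
        exact hx (by rw [h0, inner_zero_right])
    have hσU : tsupport (fun x => ⟪v x, curl (fun y => θ y • e) x⟫_ℝ) ⊆ U :=
      (closure_mono hσsupp).trans ((tsupport_curl_subset _).trans hηU)
    rw [multiplier_eq_density_on_twist_ne_zero hv hG hμ hσ hσc hσU,
      integral_inner_curl_eq_of_contDiffOn hUo hF hη hηc hηU]
    refine integral_congr_ae (Eventually.of_forall fun x => ?_)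
    show ⟪v x, curl (fun y => θ y • e) x⟫_ℝ * (⟪G x, v x⟫_ℝ / ⟪v x, curl v x⟫_ℝ) =
      ⟪(⟪G x, v x⟫_ℝ / ⟪v x, curl v x⟫_ℝ) • v x, curl (fun y => θ y • e) x⟫_ℝ
    rw [real_inner_smul_left, mul_comm]
  -- du Bois-Reymond on `U`
  have hae : ∀ᵐ x ∂(volume : Measure E3), x ∈ U →
      G x - curl (fun y => (⟪G y, v y⟫_ℝ / ⟪v y, curl v y⟫_ℝ) • v y) x = 0 := by
    refine hUo.ae_eq_zero_of_integral_contDiff_smul_eq_zero (hΦc.locallyIntegrableOn hUo.measurableSet)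
      fun θ hθ hθc hθU => ?_
    -- the integrand `θ • Φ` is continuous with compact support
    have hsupp : support (fun x => θ x • (G x - curl (fun y => (⟪G y, v y⟫_ℝ / ⟪v y, curl v y⟫_ℝ) • v y) x)) ⊆
        support θ := fun x hx => by
      rw [mem_support] at hx ⊢
      intro h0
      exact hx (by rw [h0, zero_smul])
    have hcont : Continuous fun x => θ x • (G x - curl (fun y => (⟪G y, v y⟫_ℝ / ⟪v y, curl v y⟫_ℝ) • v y) x) :=
      continuous_of_tsupport fun x hx =>
        hθ.continuous.continuousAt.smul (hΦc.continuousAt (hUo.mem_nhds (hθU ((closure_mono hsupp) hx))))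
    have hint : Integrable (fun x => θ x • (G x - curl (fun y => (⟪G y, v y⟫_ℝ / ⟪v y, curl v y⟫_ℝ) • v y) x)) :=
      hcont.integrable_of_hasCompactSupport (hθc.mono hsupp)
    refine ext_inner_left ℝ fun e => ?_
    rw [inner_zero_right, ← integral_inner hint e]
    have hpt : ∀ x, ⟪e, θ x • (G x - curl (fun y => (⟪G y, v y⟫_ℝ / ⟪v y, curl v y⟫_ℝ) • v y) x)⟫_ℝ =
        ⟪G x, θ x • e⟫_ℝ - ⟪curl (fun y => (⟪G y, v y⟫_ℝ / ⟪v y, curl v y⟫_ℝ) • v y) x, θ x • e⟫_ℝ := fun x => by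
      rw [inner_smul_right, inner_sub_right, inner_smul_right, inner_smul_right, real_inner_comm (G x),
        real_inner_comm (curl _ x)]
      ring
    rw [integral_congr_ae (Eventually.of_forall hpt)]
    have i1 : Integrable (fun x => ⟪G x, θ x • e⟫_ℝ) :=
      integrable_inner_of_hasCompactSupport_right hGs.continuous (hθ.continuous.smul continuous_const) hθc.smul_right
    have i2 : Integrable (fun x => ⟪curl (fun y => (⟪G y, v y⟫_ℝ / ⟪v y, curl v y⟫_ℝ) • v y) x, θ x • e⟫_ℝ) := by
      have hs2 : support (fun x => ⟪curl (fun y => (⟪G y, v y⟫_ℝ / ⟪v y, curl v y⟫_ℝ) • v y) x, θ x • e⟫_ℝ) ⊆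
          support θ := fun x hx => by
        rw [mem_support] at hx ⊢
        intro h0
        exact hx (by rw [h0, zero_smul, inner_zero_right])
      refine Continuous.integrable_of_hasCompactSupport ?_ (hθc.mono hs2)
      exact continuous_of_tsupport fun x hx =>
        (hcurlF.continuousAt (hUo.mem_nhds (hθU ((closure_mono hs2) hx)))).inner
          (hθ.continuous.smul continuous_const).continuousAt
    rw [integral_sub i1 i2, key θ hθ hθc hθU e, sub_self]
  have hEq := Measure.eqOn_open_of_ae_eq ((ae_restrict_iff' hUo.measurableSet).2 hae) hUo hΦc continuousOn_const
  have h := hEq hx₀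
  simp only [sub_eq_zero] at h
  exact h

/-- **The multiplier density is nonnegative: `⟪G,v⟫/⟪v,curl v⟫ ≥ 0` everywhere** (from the pointwise sign law
`⟪v,curl v⟫⟪G,v⟫ ≥ 0`; where `⟪v, curl v⟫ = 0` the quotient is `0` by convention). [folklore] -/
theorem multiplierDensity_nonneg (hv : ContDiff ℝ ∞ v) (hGc : Continuous G)
    (hG : ∀ η : E3 → E3, ContDiff ℝ ∞ η → HasCompactSupport η →
      Jst v * J1 v (curl η) - kStar ^ 2 * M ^ 2 * (Wpa v * A1 v (curl η) + Zen v * C1 v (curl η)) = ∫ x, ⟪G x, η x⟫_ℝ)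
    (hμ : ∀ φ : E3 → E3, ContDiff ℝ ∞ φ → HasCompactSupport φ → VectorCalculus.IsDivFree φ →
      Jst v * J1 v φ - kStar ^ 2 * M ^ 2 * (Wpa v * A1 v φ + Zen v * C1 v φ) = ∫ x, ⟪v x, φ x⟫_ℝ ∂μ)
    (x : E3) : 0 ≤ ⟪G x, v x⟫_ℝ / ⟪v x, curl v x⟫_ℝ := by
  have h := helicity_mul_inner_density_nonneg hv hGc hG hμ x
  exact div_nonneg_iff.2 ((mul_nonneg_iff.1 h).imp And.symm And.symm)

/-! ## The package for the residue object -/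

/-- The explicit Euler–Lagrange density of `…KStarAttainedEulerLagrange` is smooth (for `v ∈ C^∞`). [folklore] -/
theorem contDiff_density (hv : ContDiff ℝ ∞ v) (cJ ca cc : ℝ) :
    ContDiff ℝ ∞ fun x => (cJ • (curl (curl (fun y => fderiv ℝ v y (curl v y))) x -
        curl (fun y => fderiv ℝ (curl v) y (curl v y)) x +
        curl (curl (fun y => ∑ j, ⟪curl v y, fderiv ℝ v y (EuclideanSpace.basisFun (Fin 3) ℝ j)⟫_ℝ •
        EuclideanSpace.basisFun (Fin 3) ℝ j)) x) +
      ca • curl (curl (curl v)) x - cc • curl (curl (Δ (curl v))) x) := by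
  have hω : ContDiff ℝ ∞ (curl v) := contDiff_curl_top hv
  have c₁ : ContDiff ℝ ∞ (fun y => fderiv ℝ v y (curl v y)) := (hv.fderiv_right (m := ∞) le_rfl).clm_apply hω
  have c₂ : ContDiff ℝ ∞ (fun y => fderiv ℝ (curl v) y (curl v y)) := (hω.fderiv_right (m := ∞) le_rfl).clm_apply hω
  have c₃ : ContDiff ℝ ∞ (fun y => ∑ j, ⟪curl v y, fderiv ℝ v y (EuclideanSpace.basisFun (Fin 3) ℝ j)⟫_ℝ •
        EuclideanSpace.basisFun (Fin 3) ℝ j) :=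
    ContDiff.sum fun j _ => (hω.inner ℝ ((hv.fderiv_right (m := ∞) le_rfl).clm_apply contDiff_const)).smul
      contDiff_const
  have hΔ : ContDiff ℝ ∞ (Δ (curl v)) :=
    contDiff_infty.2 fun n => contDiff_laplacian (n := n) (contDiff_infty.1 hω (n + 2))
  have k₁ := contDiff_curl_top (contDiff_curl_top c₁)
  have k₂ := contDiff_curl_top c₂
  have k₃ := contDiff_curl_top (contDiff_curl_top c₃)
  have k₄ := contDiff_curl_top (contDiff_curl_top hω)
  have k₅ := contDiff_curl_top (contDiff_curl_top hΔ)
  exact (((k₁.sub k₂).add k₃).const_smul cJ |>.add (k₄.const_smul ca)).sub (k₅.const_smul cc)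

/-- **STRONG E–L PACKAGE of the K1b residue object.**  For a constant-speed extended extremiser `v` and its explicit
Euler–Lagrange density `G` (`cJ = S`, `ca = −κ⋆²M²W`, `cc = −κ⋆²M²Z` in `density_formula`) there is a finite positive
measure `μ` (`μ(ℝ³) ≤ κ⋆²ZW`) with: `ℓ = ⟪v,·⟫μ` on solenoidal test fields; `μ = (⟪G,v⟫/⟪v,curl v⟫)dx` on the twist
set (tested form); the pointwise sign law `⟪v,curl v⟫⟪G,v⟫ ≥ 0`, `⟪G,v⟫/⟪v,curl v⟫ ≥ 0`; and `G = curl((⟪G,v⟫/⟪v,curl v⟫) v)` at every point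
where `⟪v, curl v⟫ ≠ 0`. [folklore] -/
theorem residue_strongEulerLagrange (hv : ContDiff ℝ ∞ v) (hdiv : VectorCalculus.IsDivFree v) {M B : ℝ}
    (hMpos : 0 < M) (hM : ∀ x, ‖v x‖ = M) (hB : ∀ x, ‖fderiv ℝ v x‖ ≤ B)
    (h1 : ∫⁻ x, ‖iteratedFDeriv ℝ 1 v x‖ₑ ^ 2 < ⊤) (h2 : ∫⁻ x, ‖iteratedFDeriv ℝ 2 v x‖ₑ ^ 2 < ⊤)
    (hatt : |Jst v| = kStar * M * Real.sqrt (Zen v) * Real.sqrt (Wpa v)) :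
    ∃ (G : E3 → E3) (μ : Measure E3), ContDiff ℝ ∞ G ∧
      (G = fun x => (Jst v • (curl (curl (fun y => fderiv ℝ v y (curl v y))) x -
          curl (fun y => fderiv ℝ (curl v) y (curl v y)) x +
          curl (curl (fun y => ∑ j, ⟪curl v y, fderiv ℝ v y (EuclideanSpace.basisFun (Fin 3) ℝ j)⟫_ℝ •
          EuclideanSpace.basisFun (Fin 3) ℝ j)) x) +
        (-(kStar ^ 2 * M ^ 2 * Wpa v)) • curl (curl (curl v)) x -
        (-(kStar ^ 2 * M ^ 2 * Zen v)) • curl (curl (Δ (curl v))) x)) ∧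
      IsFiniteMeasure μ ∧ μ univ ≤ ENNReal.ofReal (kStar ^ 2 * Zen v * Wpa v) ∧
      (∀ φ : E3 → E3, ContDiff ℝ ∞ φ → HasCompactSupport φ → VectorCalculus.IsDivFree φ →
        Jst v * J1 v φ - kStar ^ 2 * M ^ 2 * (Wpa v * A1 v φ + Zen v * C1 v φ) = ∫ x, ⟪v x, φ x⟫_ℝ ∂μ) ∧
      (∀ θ : E3 → ℝ, ContDiff ℝ ∞ θ → HasCompactSupport θ → tsupport θ ⊆ {x | ⟪v x, curl v x⟫_ℝ ≠ 0} →
        ∫ x, θ x ∂μ = ∫ x, θ x * (⟪G x, v x⟫_ℝ / ⟪v x, curl v x⟫_ℝ)) ∧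
      (∀ x, 0 ≤ ⟪v x, curl v x⟫_ℝ * ⟪G x, v x⟫_ℝ) ∧ (∀ x, 0 ≤ ⟪G x, v x⟫_ℝ / ⟪v x, curl v x⟫_ℝ) ∧
      (∀ x, ⟪v x, curl v x⟫_ℝ ≠ 0 → G x = curl (fun y => (⟪G y, v y⟫_ℝ / ⟪v y, curl v y⟫_ℝ) • v y) x) := by
  obtain ⟨μ, hfin, hmass, hμ⟩ := exists_multiplierMeasure hv hdiv hMpos hM hB h1 h2 hatt
  set G : E3 → E3 := fun x => (Jst v • (curl (curl (fun y => fderiv ℝ v y (curl v y))) x -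
          curl (fun y => fderiv ℝ (curl v) y (curl v y)) x +
          curl (curl (fun y => ∑ j, ⟪curl v y, fderiv ℝ v y (EuclideanSpace.basisFun (Fin 3) ℝ j)⟫_ℝ •
          EuclideanSpace.basisFun (Fin 3) ℝ j)) x) +
        (-(kStar ^ 2 * M ^ 2 * Wpa v)) • curl (curl (curl v)) x -
        (-(kStar ^ 2 * M ^ 2 * Zen v)) • curl (curl (Δ (curl v))) x) with hGdef
  have hGs : ContDiff ℝ ∞ G := contDiff_density hv _ _ _
  have hG : ∀ η : E3 → E3, ContDiff ℝ ∞ η → HasCompactSupport η →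
      Jst v * J1 v (curl η) - kStar ^ 2 * M ^ 2 * (Wpa v * A1 v (curl η) + Zen v * C1 v (curl η)) =
        ∫ x, ⟪G x, η x⟫_ℝ := by
    intro η hη hηc
    have h := density_formula hv (Jst v) (-(kStar ^ 2 * M ^ 2 * Wpa v)) (-(kStar ^ 2 * M ^ 2 * Zen v)) hη hηc
    rw [hGdef, ← h]
    show Jst v * J1 v (curl η) - kStar ^ 2 * M ^ 2 * (Wpa v * A1 v (curl η) + Zen v * C1 v (curl η)) =
      Jst v * J1 v (curl η) + -(kStar ^ 2 * M ^ 2 * Wpa v) * A1 v (curl η) + -(kStar ^ 2 * M ^ 2 * Zen v) * C1 v (curl η)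
    ring
  exact ⟨G, μ, hGs, rfl, hfin, hmass, hμ,
    fun θ hθ hθc hθU => multiplier_eq_density_on_twist_ne_zero hv hG hμ hθ hθc hθU,
    fun x => helicity_mul_inner_density_nonneg hv hGs.continuous hG hμ x,
    fun x => multiplierDensity_nonneg hv hGs.continuous hG hμ x,
    fun x hx => strongEulerLagrange_on_twist_ne_zero hv hGs hG hμ hx⟩

end ExtremiserLiouville

end Summit.NavierStokesRegularity.NavierStokesRegularity.Theorems

end
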